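import Literature.AlgebraicGeometry.HodgeTheory.CMHodgeGroupSlotsHodgeClasses
import Literature.AlgebraicGeometry.HodgeTheory.CMHodgeGroupDualBases
import HarnessLib

/-!
# `Hg = U_E` (E a CM field) ⟹ the Hodge classes on all powers are generated by divisor classes, III: the coloured FFT assembly (Moonen–Zarhin 1999 (1.8) for `D = E`, Hazama / Murty; Milne 1999 Prop. 3.6 (c); Goodman–Wallach Thm. 5.3.1 per colour)

Family `hodge`, layer `Literature/AlgebraicGeometry/HodgeTheory`. Research context: cell `pub-hodgeav-hg6` (LADDER-HodgeAV
PERC-SHAPE row 2, «base of HC ladder», req-37 Q2b TABLE X; HONEST FRAMING: nothing here proves HC, HC_AV or HC_CM; not a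
corollary). UNCONDITIONAL; theorems only, no definition, no named fact (D-0026), no `sorry`. Part III of the coloured
socket (I `CMHodgeGroupSlotsHodgeClasses` = invariance theorem under `hU`; II `CMHodgeGroupDualBases` = adapted dual
bases; geometric sequel `QuarticCMHodgeGroupPowersHodgeClasses`).

This is the `ι`-COLOURED form of `QuarticCMTwoOneSlotsHodgeClasses` §4 (two colours) and of this cell's one-colour
`UnitaryHodgeGroupPowersHodgeClasses` §3: from a coefficient function killed colourwise by `∏_k 𝔤𝔩_{n₀}(ℂ)` (the output
of `AVSlots.exists_cmInvariant_coeff_of_hodgeLieC`) to `Dᵖ(B) ⊗ ℂ` by the coloured unipotent bridge, the tensor FFT for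
`∏_k GL(W_{μ k})` (colour-preserving complete contractions, `mem_span_contractionTensor_of_forall_wordDerAt_mixedLieFamilyAt_eq_zero`)
and Milne's product formula (each contraction is `±` a product of crossed classes `∑_ℓ g_j^* cb((k,0),ℓ) ⌣ g_{j'}^* cb((k,1),ℓ)`
of ONE colour each). CREDIT: the 45-line FFT body is that of `AVSlots.quarticHodgeClasses_divisorial` (cell
pub-hodge-ring2, R10) with `Fin 2 ↦ ι`, restated once for arbitrary letter families; nothing else is re-proved.

THE PRINT. MZ99 (1.8) [corpus: paper:arxiv-math_9901113 p0004 L72–88]: «Hazama and Murty (independently):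
`Hg(X) = Sp_D(V,φ)` ⟺ (no factors of type III and `D(Xⁿ) = B(Xⁿ)` for all `n`)»; for `D = E` a CM field
`Sp_E(V,φ) = U_E(V,ψ)` ((2.3)), `U_E(ℂ) = ∏_σ GL(W_σ)` over half the places (Deligne §4). Milne 1999 Prop. 3.6 (c): the
invariants of `∏ GL` in the mixed tensor algebra are generated in degree `2` («each of which is visibly a product of
2-forms»).

MAIN RESULTS.
* §1 `HodgeStructure.CMTheta.finrank_eigenspace_eq_add` — `dim W_c = dim(W_c ∩ V^{1,0}) + dim(W_c ∩ V^{0,1})` (`W_c` is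
  `Θ`-graded): the counting lemma by which the geometric sequel discharges `hrank` / `htop` of `CMTheta.exists_adaptedDualBasis`.
* §2 `AVSlots.mem_divisorClassesSpan_of_cmCoeff` (ANY letter family `y₀ : (ι × Fin 2) × Fin n₀ → H¹(A(ℂ); ℂ)` with
  divisorial crossed classes per colour, ANY colourwise-killed coefficient function ⟹ `c ∈ Dᵖ(B) ⊗ ℂ`),
  `AVSlots.cmHodgeClasses_divisorial_of_hodgeLieC`, **`AVSlots.isDivisorGenerated_of_cmData_of_hodgeLieC`** (`B = D` on
  every `B` with slots over `A` from: a polarization `ψ`, `φ ∈ End`, `hU`, adapted dual bases, divisorial crossed classes).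

## References

* [MoonenZarhin1999LowDim] B. Moonen, Yu. Zarhin, Math. Ann. 315 (1999) = arXiv:math/9901113, §1 (1.8), §2 (2.3), §3 (3.1).
* [Hazama1983] F. Hazama, Tôhoku Math. J. 35 (1983), Thm. (1.1), §3 pp. 305–306.
* [Murty1984] V. K. Murty, Math. Ann. 268 (1984), Thm. 3.1, §3.
* [Milne1999LefschetzClasses] J. S. Milne, Duke Math. J. 96 (1999), Prop. 3.3, Prop. 3.6 (c), Remark 3.7 (pp. 655–656).
* [GoodmanWallachGTM255] R. Goodman, N. R. Wallach, GTM 255 (2009), Thm. 2.2.2, Thm. 5.3.1.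
* [Deligne1982HodgeCycles] P. Deligne, LNM 900 (1982), I §3, §4 (p. 30).
* [Ribet1983] K. A. Ribet, Amer. J. Math. 105 (1983), Thm. 0.
-/

noncomputable section

open scoped TensorProduct
open scoped Matrix
open CategoryTheory Module

/-! ### §1 The eigenspaces of `φ_ℂ` are `Θ`-graded -/

namespace Literature.AlgebraicGeometry.Motives

namespace HodgeStructure

section Grading

universe u

variable {V : Type u} [AddCommGroup V] [Module ℚ V] {n : ℤ}

/-- **Each eigenspace `W_c` of `φ_ℂ` (`φ ∈ End_Hdg`) is `Θ`-graded: `dim W_c = dim (W_c ∩ V^{1,0}) + dim (W_c ∩ V^{0,1})`**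
(`Θ` commutes with `φ_ℂ` and `w = ½(w + Θw) + ½(w − Θw)`; `V^{1,0} ∩ V^{0,1} = 0`). MZ99 §1: «`n_σ + n_σ̄ = m`».
[cite: MoonenZarhin1999LowDim, §1] [cite: Deligne1982HodgeCycles, §4 (p. 30)] -/
theorem CMTheta.finrank_eigenspace_eq_add [Module.Finite ℚ V] [HodgeTensorFacts.{u, u}] (H : HodgeStructure V n)
    (hn : n = 1) (heff : H.IsEffective) {φ : Module.End ℚ V} (hφE : φ ∈ H.endAlg) (c : ℂ) :
    Module.finrank ℂ ↥(Module.End.eigenspace (φ.baseChange ℂ) c) =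
      Module.finrank ℂ ↥(Module.End.eigenspace (φ.baseChange ℂ) c ⊓ H.piece 1 0) +
        Module.finrank ℂ ↥(Module.End.eigenspace (φ.baseChange ℂ) c ⊓ H.piece 0 1) := by
  obtain ⟨Θ, hΘ⟩ := exists_hodgeTheta H
  have hΘφ : Θ * φ.baseChange ℂ = φ.baseChange ℂ * Θ :=
    commute_baseChange_of_mem_hodgeLieC H (H.mem_hodgeLieC_of_forall_piece hΘ) ⟨φ, hφE⟩
  obtain ⟨hP, hQ, hΘ10, hΘ01, -⟩ := UnitaryTheta.theta_facts H hn heff hΘ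
  subst hn
  set W := Module.End.eigenspace (φ.baseChange ℂ) c with hWdef
  have hΘW : ∀ w ∈ W, Θ w ∈ W := fun w hw => UnitaryTheta.apply_mem_eigenspace_of_commute hΘφ hw
  have hsup : W ⊓ H.piece 1 0 ⊔ W ⊓ H.piece 0 1 = W := by
    refine le_antisymm (sup_le inf_le_left inf_le_left) fun w hw => ?_
    have hw_eq : w = (2 : ℂ)⁻¹ • (w + Θ w) + (2 : ℂ)⁻¹ • (w - Θ w) := by module
    rw [hw_eq]
    exact Submodule.add_mem _
      (Submodule.mem_sup_left ⟨Submodule.smul_mem _ _ (Submodule.add_mem _ hw (hΘW w hw)), hP w⟩)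
      (Submodule.mem_sup_right ⟨Submodule.smul_mem _ _ (Submodule.sub_mem _ hw (hΘW w hw)), hQ w⟩)
  have hinf : (W ⊓ H.piece 1 0) ⊓ (W ⊓ H.piece 0 1) = ⊥ := by
    rw [Submodule.eq_bot_iff]
    rintro x ⟨⟨-, hx1⟩, ⟨-, hx0⟩⟩
    have h1 : Θ x = x := hΘ10 x hx1
    have h0 : Θ x = -x := hΘ01 x hx0
    have h2 : (2 : ℂ) • x = 0 := by
      rw [two_smul]
      nth_rw 2 [← h1]
      rw [h0, add_neg_cancel]
    exact (smul_eq_zero.1 h2).resolve_left two_ne_zero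
  have h := Submodule.finrank_sup_add_finrank_inf_eq (W ⊓ H.piece 1 0) (W ⊓ H.piece 0 1)
  rw [hsup, hinf, finrank_bot, add_zero] at h
  exact h

end Grading

end HodgeStructure

end Literature.AlgebraicGeometry.Motives

/-! ### §2 The coloured assembly: `Bᵖ(B) ⊆ Dᵖ(B) ⊗ ℂ` by the coloured unipotent bridge, the tensor FFT for `∏_k GL(W_{μ k})` and the crossed classes -/

namespace Literature.AlgebraicGeometry.HodgeTheory

open Literature.AlgebraicTopology.SingularHomology
open Literature.AlgebraicGeometry.Motives (IsSmoothProjective AbelianVariety bettiCohomology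
  ofRatClassBaseChange ofRatClassBaseChange_tmul HodgeTensorFacts hodgeTensorFacts_holds)
open Literature.Barriers.HodgeConjecture
open Literature.AlgebraicGeometry.Motives.HodgeStructure
open Literature.RepresentationTheory.GeneralLinear
open Literature.RepresentationTheory.ClassicalInvariants
open Literature.NumberTheory.DiophantineGeometry

section CMAssembly

variable {A B : AbelianVariety ℂ} {n : ℕ} {g : Fin n → (B ⟶ A)} {ι : Type} [Fintype ι] [DecidableEq ι]

open scoped Classical in
/-- **From a colourwise-killed coefficient function to `Dᵖ(B) ⊗ ℂ`** (the FFT half of the coloured assembly, for ANY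
letter family `y₀ : (ι × Fin 2) × Fin n₀ → H¹(A(ℂ); ℂ)` of vectors `y₀((k,0),ℓ)` and covectors `y₀((k,1),ℓ)` per colour
`k`): if `c = ∑_w a(w)·(g y₀)_w` with every slice of `a` killed, for each colour `k` and every `X ∈ 𝔤𝔩_{n₀}(ℂ)`, by the typed
differential of `X` at the positions of colour `k`, and the CROSSED CLASSES `∑_ℓ g_j^* y₀((k,0),ℓ) ⌣ g_{j'}^* y₀((k,1),ℓ)` lie in
`B¹(B) ⊗ ℂ` (`hcross`), then `c ∈ Dᵖ(B) ⊗ ℂ`: coloured Lie invariance ⟹ `∏_k GL`-invariance (Goodman–Wallach Thm. 2.2.2) ⟹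
colour-preserving complete contractions (`mem_span_contractionTensor_of_forall_wordDerAt_mixedLieFamilyAt_eq_zero`, tensor
FFT per colour, Goodman–Wallach Thm. 5.3.1) ⟹ `±` products of crossed classes of one colour each
(`Milne1999.sum_contractionTensor_smul_eq`, `sum_cupPowOne_glPairWord_mem`). This is the body of the tree's
`AVSlots.quarticHodgeClasses_divisorial` (`Fin 2 ↦ ι`), stated once for every producer of killed coefficient functions.
[cite: Milne1999LefschetzClasses, Prop. 3.6 (c) and Remark 3.7 (pp. 655–656)] [cite: GoodmanWallachGTM255, Thm. 2.2.2 and Thm. 5.3.1]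
[cite: MoonenZarhin1999LowDim, §3 (3.1)] -/
theorem AVSlots.mem_divisorClassesSpan_of_cmCoeff (hg : AVSlots A B g) {n₀ : ℕ}
    (y₀ : (ι × Fin 2) × Fin n₀ → complexBetti A.X 1)
    (hcross : ∀ (j j' : Fin n) (k : ι), (∑ ℓ : Fin n₀, cupProduct (rfl : 1 + 1 = 2)
        (avLetters g y₀ (j, ((k, (0 : Fin 2)), ℓ))) (avLetters g y₀ (j', ((k, (1 : Fin 2)), ℓ)))) ∈
      Submodule.span ℂ {c : complexBetti B.X 2 | IsRationalClass c ∧ IsOfHodgeType B.dim B.X 2 1 1 c})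
    {p : ℕ} {c : complexBetti B.X (2 * p)} (a : (Fin (2 * p) → (Fin n × (ι × Fin 2)) × Fin n₀) → ℂ)
    (hca : wordEval (cupPowOneAlt ℂ (Motives.ComplexPoints B.X) (2 * p))
        (fun x : (Fin n × (ι × Fin 2)) × Fin n₀ => avLetters g y₀ (x.1.1, (x.1.2, x.2))) a = c)
    (hkill : ∀ (U : Fin (2 * p) → Fin n × (ι × Fin 2)) (k : ι) (X : Matrix (Fin n₀) (Fin n₀) ℂ),
        wordDerAt ℂ (fun t => if (U t).2.1 = k then (if (U t).2.2 = 0 then X else -Xᵀ) else 0)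
          (wordSlice a U) = 0) :
    c ∈ divisorClassesSpan B.X B.dim p := by
  classical
  have _ := hg
  set y : (Fin n × (ι × Fin 2)) × Fin n₀ → complexBetti B.X 1 := fun x => avLetters g y₀ (x.1.1, (x.1.2, x.2))
    with hy
  set F := cupPowOneAlt ℂ (Motives.ComplexPoints B.X) (2 * p) with hF
  rw [← hca, wordEval_eq_sum_wordSlice]
  refine Submodule.sum_mem _ fun U _ => ?_
  -- coloured Lie invariance ⟹ `∏_k GL(W_{μ k})`-invariance ⟹ colour-preserving complete contractions
  set ty : Fin (2 * p) → Bool := fun t => decide ((U t).2.2 = 0) with hty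
  set col : Fin (2 * p) → ι := fun t => (U t).2.1 with hcol
  have hLie : ∀ (i : ι) (X : Matrix (Fin n₀) (Fin n₀) ℂ),
      wordDerAt ℂ (mixedLieFamilyAt col ty i X) (wordSlice a U) = 0 := by
    intro i X
    have hfam : mixedLieFamilyAt col ty i X = fun t => if (U t).2.1 = i then (if (U t).2.2 = 0 then X else -Xᵀ)
        else 0 := by
      funext t
      simp only [mixedLieFamilyAt, mixedLieFamily, hty, hcol, decide_eq_true_eq]
    rw [hfam]
    exact hkill U i X
  have hmem := mem_span_contractionTensor_of_forall_wordDerAt_mixedLieFamilyAt_eq_zero col ty hLie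
  set Λ := Fintype.linearCombination ℂ (fun ε : Word n₀ (2 * p) => F (fun q => y (U q, ε q))) with hΛ
  have hΛapply : ∀ cf : Word n₀ (2 * p) → ℂ, Λ cf = ∑ ε, cf ε • F (fun q => y (U q, ε q)) :=
    fun cf => Fintype.linearCombination_apply ℂ _ cf
  rw [← hΛapply]
  refine (Submodule.span_le (p := (divisorClassesSpan B.X B.dim p).comap Λ)).2 ?_ hmem
  rintro _ ⟨β, hβcol, rfl⟩
  rw [SetLike.mem_coe, Submodule.mem_comap, hΛapply]
  -- evaluation of a colour-preserving complete contraction: `±` a product of crossed classes of one colour each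
  obtain ⟨π, eP, hsum⟩ := Milne1999.sum_contractionTensor_smul_eq F ty β y U
  rw [hsum]
  refine Submodule.smul_mem _ _ ?_
  simp_rw [hF, cupPowOneAlt_apply]
  refine Milne1999.sum_cupPowOne_glPairWord_mem y p _ _ fun i => ?_
  have h0 : (U (eP.symm i : Fin (2 * p))).2.2 = 0 := by
    have h := (eP.symm i).2
    simpa [hty] using h
  have h1' : (U (β (eP.symm i) : Fin (2 * p))).2.2 = 1 := by
    have h := (β (eP.symm i)).2
    simp only [hty, decide_eq_false_iff_not] at h
    rcases Fin.eq_zero_or_eq_succ (U (β (eP.symm i) : Fin (2 * p))).2.2 with h' | ⟨j, hj⟩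
    · exact absurd h' h
    · rw [hj, Fin.eq_zero j]; rfl
  have hc' : (U (β (eP.symm i) : Fin (2 * p))).2.1 = (U (eP.symm i : Fin (2 * p))).2.1 := hβcol (eP.symm i)
  have hyU : ∀ (q : Fin (2 * p)) (ℓ : Fin n₀), y (U q, ℓ) = avLetters g y₀ ((U q).1, (((U q).2.1, (U q).2.2), ℓ)) :=
    fun q ℓ => rfl
  simp only [hyU, h0, h1', hc']
  exact hcross _ _ _

open scoped Classical in
/-- **`Bᵖ(B) ⊆ Dᵖ(B) ⊗ ℂ` for an abelian variety `B` with slots over `A` carrying CM data with `Hg = U_E` (Lie form `hU`)**: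
the data of `AVSlots.exists_cmInvariant_coeff_of_hodgeLieC` (a polarization `ψ`, `φ ∈ End`, colours `μ : ι → ℂ`, adapted
dual bases `cb` with kinds `κ` and the pairing table) plus divisorial crossed classes per colour (`hcross`). MZ99 (1.8) ⟹
for `D = E`: «`Hg(X) = Sp_D(V,φ)` ⟹ `D(Xⁿ) = B(Xⁿ)` for all `n`» (Hazama, Murty); Ribet Thm. 0.
[cite: MoonenZarhin1999LowDim, §1 (1.8) and §2 (2.3)] [cite: Ribet1983, Thm. 0]
[cite: Milne1999LefschetzClasses, Prop. 3.6 (c) and Remark 3.7] -/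
theorem AVSlots.cmHodgeClasses_divisorial_of_hodgeLieC [HodgeTensorFacts.{0, 0}] (hg : AVSlots A B g)
    (hHD : exists_isReal_hodgeModel) (hI : hodgePQ_independent_of_hodgeModel)
    (ψ : (BettiUniverse.hodge hHD (AbelianVariety.isSmoothProjective_holds (A := A)) 1).Polarization)
    {φ : Module.End ℚ (bettiCohomology A.X 1)}
    (hU : ∀ Y : Module.End ℂ (ℂ ⊗[ℚ] bettiCohomology A.X 1), Y * φ.baseChange ℂ = φ.baseChange ℂ * Y →
      (∀ x y, ψ.form.baseChange ℂ (Y x) y + ψ.form.baseChange ℂ x (Y y) = 0) →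
        Y ∈ (BettiUniverse.hodge hHD (AbelianVariety.isSmoothProjective_holds (A := A)) 1).hodgeLieC)
    (μ : ι → ℂ) {n₀ : ℕ} (cb : Module.Basis ((ι × Fin 2) × Fin n₀) ℂ (ℂ ⊗[ℚ] bettiCohomology A.X 1))
    (κ : ι × Fin n₀ → Fin 2)
    (hcbW : ∀ k ℓ, cb ((k, 0), ℓ) ∈ Module.End.eigenspace (φ.baseChange ℂ) (μ k))
    (hcbW' : ∀ k ℓ, cb ((k, 1), ℓ) ∈ Module.End.eigenspace (φ.baseChange ℂ) (starRingEnd ℂ (μ k)))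
    (hcb0 : ∀ k ℓ, κ (k, ℓ) = 0 →
      cb ((k, 0), ℓ) ∈ (BettiUniverse.hodge hHD (AbelianVariety.isSmoothProjective_holds (A := A)) 1).piece 1 0 ∧
      cb ((k, 1), ℓ) ∈ (BettiUniverse.hodge hHD (AbelianVariety.isSmoothProjective_holds (A := A)) 1).piece 0 1)
    (hcb1 : ∀ k ℓ, κ (k, ℓ) = 1 →
      cb ((k, 0), ℓ) ∈ (BettiUniverse.hodge hHD (AbelianVariety.isSmoothProjective_holds (A := A)) 1).piece 0 1 ∧
      cb ((k, 1), ℓ) ∈ (BettiUniverse.hodge hHD (AbelianVariety.isSmoothProjective_holds (A := A)) 1).piece 1 0)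
    (hdual : ∀ k k' i j, ψ.form.baseChange ℂ (cb ((k, 0), i)) (cb ((k', 1), j)) =
      if k = k' ∧ i = j then 1 else 0)
    (hiso : ∀ k k' (t : Fin 2) i j, ψ.form.baseChange ℂ (cb ((k, t), i)) (cb ((k', t), j)) = 0)
    (hcross : ∀ (j j' : Fin n) (k : ι), (∑ ℓ : Fin n₀, cupProduct (rfl : 1 + 1 = 2)
        (avLetters g (fun tl : (ι × Fin 2) × Fin n₀ =>
          ofRatClassBaseChange (Motives.ComplexPoints A.X) 1 (cb tl)) (j, ((k, (0 : Fin 2)), ℓ)))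
        (avLetters g (fun tl : (ι × Fin 2) × Fin n₀ =>
          ofRatClassBaseChange (Motives.ComplexPoints A.X) 1 (cb tl)) (j', ((k, (1 : Fin 2)), ℓ)))) ∈
      Submodule.span ℂ {c : complexBetti B.X 2 | IsRationalClass c ∧ IsOfHodgeType B.dim B.X 2 1 1 c})
    (p : ℕ) (c : complexBetti B.X (2 * p)) (hcQ : IsRationalClass c)
    (hc : IsOfHodgeType B.dim B.X (2 * p) p p c) :
    c ∈ divisorClassesSpan B.X B.dim p := by
  classical
  rcases Nat.eq_zero_or_pos p with rfl | hp
  · exact AbelianVariety.mem_divisorClassesSpan_zero B c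
  obtain ⟨a, hca, hkill⟩ := hg.exists_cmInvariant_coeff_of_hodgeLieC hHD hI ψ hU μ cb κ hcbW hcbW' hcb0 hcb1
    hdual hiso hp hcQ hc
  exact hg.mem_divisorClassesSpan_of_cmCoeff
    (fun tl : (ι × Fin 2) × Fin n₀ => ofRatClassBaseChange (Motives.ComplexPoints A.X) 1 (cb tl)) hcross a hca hkill

/-- **`IsDivisorGenerated B`** (`B•(B) = D•(B) ⊗ ℂ`) for every abelian variety `B` with slots over an abelian variety `A`
carrying CM data (`E ∋ φ`, colours `μ : ι → ℂ`) with `Hg = U_E` in the Lie form `hU`, adapted dual bases and divisorial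
crossed classes — any degree, any multiplicities. [cite: MoonenZarhin1999LowDim, §1 (1.8)] [cite: Ribet1983, Thm. 0]
[cite: Milne1999LefschetzClasses, Prop. 3.6 (c)] -/
theorem AVSlots.isDivisorGenerated_of_cmData_of_hodgeLieC [HodgeTensorFacts.{0, 0}] (hg : AVSlots A B g)
    (hHD : exists_isReal_hodgeModel) (hI : hodgePQ_independent_of_hodgeModel)
    (ψ : (BettiUniverse.hodge hHD (AbelianVariety.isSmoothProjective_holds (A := A)) 1).Polarization)
    {φ : Module.End ℚ (bettiCohomology A.X 1)}
    (hU : ∀ Y : Module.End ℂ (ℂ ⊗[ℚ] bettiCohomology A.X 1), Y * φ.baseChange ℂ = φ.baseChange ℂ * Y →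
      (∀ x y, ψ.form.baseChange ℂ (Y x) y + ψ.form.baseChange ℂ x (Y y) = 0) →
        Y ∈ (BettiUniverse.hodge hHD (AbelianVariety.isSmoothProjective_holds (A := A)) 1).hodgeLieC)
    (μ : ι → ℂ) {n₀ : ℕ} (cb : Module.Basis ((ι × Fin 2) × Fin n₀) ℂ (ℂ ⊗[ℚ] bettiCohomology A.X 1))
    (κ : ι × Fin n₀ → Fin 2)
    (hcbW : ∀ k ℓ, cb ((k, 0), ℓ) ∈ Module.End.eigenspace (φ.baseChange ℂ) (μ k))
    (hcbW' : ∀ k ℓ, cb ((k, 1), ℓ) ∈ Module.End.eigenspace (φ.baseChange ℂ) (starRingEnd ℂ (μ k)))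
    (hcb0 : ∀ k ℓ, κ (k, ℓ) = 0 →
      cb ((k, 0), ℓ) ∈ (BettiUniverse.hodge hHD (AbelianVariety.isSmoothProjective_holds (A := A)) 1).piece 1 0 ∧
      cb ((k, 1), ℓ) ∈ (BettiUniverse.hodge hHD (AbelianVariety.isSmoothProjective_holds (A := A)) 1).piece 0 1)
    (hcb1 : ∀ k ℓ, κ (k, ℓ) = 1 →
      cb ((k, 0), ℓ) ∈ (BettiUniverse.hodge hHD (AbelianVariety.isSmoothProjective_holds (A := A)) 1).piece 0 1 ∧
      cb ((k, 1), ℓ) ∈ (BettiUniverse.hodge hHD (AbelianVariety.isSmoothProjective_holds (A := A)) 1).piece 1 0)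
    (hdual : ∀ k k' i j, ψ.form.baseChange ℂ (cb ((k, 0), i)) (cb ((k', 1), j)) =
      if k = k' ∧ i = j then 1 else 0)
    (hiso : ∀ k k' (t : Fin 2) i j, ψ.form.baseChange ℂ (cb ((k, t), i)) (cb ((k', t), j)) = 0)
    (hcross : ∀ (j j' : Fin n) (k : ι), (∑ ℓ : Fin n₀, cupProduct (rfl : 1 + 1 = 2)
        (avLetters g (fun tl : (ι × Fin 2) × Fin n₀ =>
          ofRatClassBaseChange (Motives.ComplexPoints A.X) 1 (cb tl)) (j, ((k, (0 : Fin 2)), ℓ)))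
        (avLetters g (fun tl : (ι × Fin 2) × Fin n₀ =>
          ofRatClassBaseChange (Motives.ComplexPoints A.X) 1 (cb tl)) (j', ((k, (1 : Fin 2)), ℓ)))) ∈
      Submodule.span ℂ {c : complexBetti B.X 2 | IsRationalClass c ∧ IsOfHodgeType B.dim B.X 2 1 1 c}) :
    IsDivisorGenerated B :=
  fun p c hcQ hc => hg.cmHodgeClasses_divisorial_of_hodgeLieC hHD hI ψ hU μ cb κ hcbW hcbW' hcb0 hcb1 hdual hiso
    hcross p c hcQ hc

end CMAssembly

end Literature.AlgebraicGeometry.HodgeTheory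

end
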